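import Summits.AtomisticToContinuum.Crystallization.Theorems.ChessboardParticlePlanesPeriodicWindowsShapeStationarity3
import Summits.AtomisticToContinuum.Crystallization.Theorems.ExcessDecayLiouvilleCoarseGrainsPinTail

/-!
# Crux `PeriodicWindows` (stmt-AtomisticToContinuum-3240), line `Sketch` — stub E2a, part 4: index cubes and the boundary functional

Helper file for the registered stub `stub_shapeStationarity` (E2a) of the lead skeleton `PeriodicWindowsSketch`
(rev 9). The averaging windows of the scaling argument are the images `W_K = e([-K,K]³)` of the INDEX CUBES
(`ExcessDecayLiouvilleCoarseGrains.hcpSumCube K`) under the parametrisation `e (k,i,j) = A (barlowPos a h s k i j)` of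
the rotated stacking `S = A '' barlowStacking a h s`:

* `shp_cube_card`, `shp_cube_subset` — `#W_K = (2K+1)³`, `W_K ⊆ S`;
* `shp_sum_cube_layer` — a layer function sums to `(2K+1)² ∑_{|k| ≤ K} f k` over `W_K`;
* `shp_le_infDist_cube` — a point of `W_K` with index of sup-norm `≤ M` is at distance `≥ (min a h / 8)(K + 1 − M)` from
  `S ∖ W_K` (co-Lipschitz bound of part 1);
* `shp_boundary_small` — **the boundary functional is `o(#W_K)`**: for every `ε > 0`, eventually in `K`,
  `∑_{p ∈ W_K} (1 + dist(p, S ∖ W_K))⁻³ ≤ ε (2K+1)³` (deep points have a small weight, the collar is thin).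

All `[folklore]`.
-/

noncomputable section

namespace Summit.AtomisticToContinuum.Crystallization.Theorems.PeriodicWindowsSketch

open Literature.MathematicalPhysics.StatisticalMechanics
open Summit.AtomisticToContinuum.Crystallization.Theorems.ExcessDecayLiouvilleCoarseGrains
  (hcpSumCube hcpSum_mem_hcpSumCube hcpSumCube_mono hcpSum_card_hcpSumCube hcpSum_not_mem_hcpSumCube)

/-! ## The cube windows -/

/-- `#W_K = (2K+1)³` (the parametrisation is injective for `a, h > 0`). [folklore] -/
theorem shp_cube_card {a h : ℝ} (ha : 0 < a) (hh : 0 < h) (s : ℤ → ℤ)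
    (A : EuclideanSpace ℝ (Fin 3) →ₗᵢ[ℝ] EuclideanSpace ℝ (Fin 3)) (K : ℕ) :
    ((hcpSumCube K).image fun t : ℤ × ℤ × ℤ => A (barlowPos a h s t.1 t.2.1 t.2.2)).card = (2 * K + 1) ^ 3 := by
  rw [Finset.card_image_of_injective _ (shp_param_injective ha hh s A), hcpSum_card_hcpSumCube]

/-- `W_K ⊆ S`. [folklore] -/
theorem shp_cube_subset (a h : ℝ) (s : ℤ → ℤ) (A : EuclideanSpace ℝ (Fin 3) →ₗᵢ[ℝ] EuclideanSpace ℝ (Fin 3))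
    (K : ℕ) :
    (↑((hcpSumCube K).image fun t : ℤ × ℤ × ℤ => A (barlowPos a h s t.1 t.2.1 t.2.2)) :
        Set (EuclideanSpace ℝ (Fin 3))) ⊆ A '' barlowStacking a h s := by
  intro p hp
  rw [Finset.coe_image] at hp
  obtain ⟨t, -, rfl⟩ := hp
  exact ⟨_, barlowPos_mem _ _ _, rfl⟩

/-- **A layer function summed over the cube window**: `∑_{p ∈ W_K} F p = (2K+1)² ∑_{k = -K}^{K} f k` when
`F (e (k,i,j)) = f k`. [folklore] -/
theorem shp_sum_cube_layer {a h : ℝ} (ha : 0 < a) (hh : 0 < h) (s : ℤ → ℤ)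
    (A : EuclideanSpace ℝ (Fin 3) →ₗᵢ[ℝ] EuclideanSpace ℝ (Fin 3)) (K : ℕ) (F : EuclideanSpace ℝ (Fin 3) → ℝ)
    (f : ℤ → ℝ) (hF : ∀ t : ℤ × ℤ × ℤ, F (A (barlowPos a h s t.1 t.2.1 t.2.2)) = f t.1) :
    ∑ p ∈ (hcpSumCube K).image (fun t : ℤ × ℤ × ℤ => A (barlowPos a h s t.1 t.2.1 t.2.2)), F p =
      ((2 * K + 1 : ℕ) : ℝ) ^ 2 * ∑ k ∈ Finset.Icc (-(K : ℤ)) K, f k := by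
  rw [Finset.sum_image fun x _ y _ hxy => shp_param_injective ha hh s A hxy]
  simp only [hF]
  rw [hcpSumCube, Finset.sum_product, Finset.mul_sum]
  refine Finset.sum_congr rfl fun k _ => ?_
  simp only [Finset.sum_const, Finset.card_product, Int.card_Icc]
  have : ((K : ℤ) + 1 - -(K : ℤ)).toNat = 2 * K + 1 := by omega
  rw [this]
  push_cast
  ring

/-! ## Distance to the complement of a cube window -/

/-- The sup-norm of an index, as a real number. [folklore] -/
theorem shp_abs_sub_ge_of_le {x y : ℤ} {M K : ℝ} (hx : |(x : ℝ)| ≤ M) (hy : K + 1 ≤ |(y : ℝ)|) :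
    K + 1 - M ≤ |((y - x : ℤ) : ℝ)| := by
  push_cast
  have := abs_sub_abs_le_abs_sub (y : ℝ) (x : ℝ)
  linarith

/-- **Distance to the complement of the cube window.** For `a, h > 0`, a Hägg sequence `s`, an index `t` with
`|t.1|, |t.2.1|, |t.2.2| ≤ M` and any cube index `K`: every point of `S ∖ W_K` is at distance
`≥ (min a h / 8) (K + 1 − M)` from `e t`, hence so is `infDist`. [folklore] -/
theorem shp_le_infDist_cube {a h : ℝ} (ha : 0 < a) (hh : 0 < h) {s : ℤ → ℤ} (hs : IsHaggSeq s)
    (A : EuclideanSpace ℝ (Fin 3) →ₗᵢ[ℝ] EuclideanSpace ℝ (Fin 3)) (K : ℕ) (t : ℤ × ℤ × ℤ) {M : ℝ}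
    (hM : max |(t.1 : ℝ)| (max |(t.2.1 : ℝ)| |(t.2.2 : ℝ)|) ≤ M) :
    min a h / 8 * ((K : ℝ) + 1 - M) ≤ Metric.infDist (A (barlowPos a h s t.1 t.2.1 t.2.2))
      (A '' barlowStacking a h s \
        ↑((hcpSumCube K).image fun t : ℤ × ℤ × ℤ => A (barlowPos a h s t.1 t.2.1 t.2.2))) := by
  set e : ℤ × ℤ × ℤ → EuclideanSpace ℝ (Fin 3) := fun t => A (barlowPos a h s t.1 t.2.1 t.2.2) with he
  have hinj : Function.Injective e := shp_param_injective ha hh s A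
  have hκ : 0 ≤ min a h / 8 := by positivity
  -- the complement is non-empty: the index `(K+1, 0, 0)` is outside the cube
  have hout : e ((K : ℤ) + 1, 0, 0) ∈ A '' barlowStacking a h s \ ↑((hcpSumCube K).image e) := by
    refine ⟨⟨_, barlowPos_mem _ _ _, rfl⟩, fun hmem => ?_⟩
    rw [Finset.coe_image] at hmem
    obtain ⟨t', ht', heq⟩ := hmem
    have := hinj heq
    subst this
    rw [Finset.mem_coe, hcpSum_mem_hcpSumCube] at ht'
    have h1 := ht'.1
    simp only at h1
    have : |((K : ℤ) + 1)| = (K : ℤ) + 1 := abs_of_nonneg (by positivity)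
    omega
  refine (Metric.le_infDist ⟨_, hout⟩).2 fun q hq => ?_
  obtain ⟨⟨q', hq', rfl⟩, hqW⟩ := hq
  obtain ⟨k, i, j, rfl⟩ := hq'
  -- the index of `q` is outside the cube
  have hnot : ((k, i, j) : ℤ × ℤ × ℤ) ∉ hcpSumCube K := fun hmem =>
    hqW (by rw [Finset.coe_image]; exact ⟨(k, i, j), hmem, rfl⟩)
  rw [hcpSum_not_mem_hcpSumCube] at hnot
  simp only at hnot
  -- the distance in the stacking dominates the index gap
  have hM1 : |(t.1 : ℝ)| ≤ M := (le_max_left _ _).trans hM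
  have hM2 : |(t.2.1 : ℝ)| ≤ M := ((le_max_left _ _).trans (le_max_right _ _)).trans hM
  have hM3 : |(t.2.2 : ℝ)| ≤ M := ((le_max_right _ _).trans (le_max_right _ _)).trans hM
  have hdist : dist (e t) (A (barlowPos a h s k i j)) =
      dist (barlowPos a h s t.1 0 0) (barlowPos a h s k (i - t.2.1) (j - t.2.2)) := by
    rw [he, LinearIsometry.dist_map, ← shp_dist_shift a h s t.1 t.2.1 t.2.2 k (i - t.2.1) (j - t.2.2),
      sub_add_cancel, sub_add_cancel]
  have hge := shp_dist_barlowPos_ge ha.le hh.le hs t.1 k (i - t.2.1) (j - t.2.2)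
  rw [← hdist] at hge
  refine le_trans (mul_le_mul_of_nonneg_left ?_ hκ) hge
  -- `K + 1 − M ≤` the sup-norm of the index gap
  rcases hnot with h1 | h2 | h3
  · have h1' : (K : ℝ) + 1 ≤ |(k : ℝ)| := by exact_mod_cast h1
    exact (shp_abs_sub_ge_of_le hM1 h1').trans (le_max_left _ _)
  · have h2' : (K : ℝ) + 1 ≤ |(i : ℝ)| := by exact_mod_cast h2
    exact (shp_abs_sub_ge_of_le hM2 h2').trans ((le_max_left _ _).trans (le_max_right _ _))
  · have h3' : (K : ℝ) + 1 ≤ |(j : ℝ)| := by exact_mod_cast h3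
    exact (shp_abs_sub_ge_of_le hM3 h3').trans ((le_max_right _ _).trans (le_max_right _ _))

/-! ## The boundary functional is `o(#W_K)` -/

/-- The boundary weight of a point is at most `1`. [folklore] -/
theorem shp_weight_le_one (p : EuclideanSpace ℝ (Fin 3)) (T : Set (EuclideanSpace ℝ (Fin 3))) :
    (1 + Metric.infDist p T)⁻¹ ^ 3 ≤ 1 := by
  have h0 : 0 ≤ Metric.infDist p T := Metric.infDist_nonneg
  have h1 : (1 + Metric.infDist p T)⁻¹ ≤ 1 := inv_le_one_of_one_le₀ (by linarith)
  have h2 : 0 ≤ (1 + Metric.infDist p T)⁻¹ := by positivity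
  calc (1 + Metric.infDist p T)⁻¹ ^ 3 ≤ 1 ^ 3 := pow_le_pow_left₀ h2 h1 3
    _ = 1 := one_pow 3

/-- The boundary weight of a deep point is small: if `dist(p, T) ≥ D ≥ 0` then the weight is `≤ (1 + D)⁻³`. [folklore] -/
theorem shp_weight_le_of_le_infDist {p : EuclideanSpace ℝ (Fin 3)} {T : Set (EuclideanSpace ℝ (Fin 3))} {D : ℝ}
    (hD : 0 ≤ D) (h : D ≤ Metric.infDist p T) :
    (1 + Metric.infDist p T)⁻¹ ^ 3 ≤ (1 + D)⁻¹ ^ 3 := by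
  have h1 : (1 + Metric.infDist p T)⁻¹ ≤ (1 + D)⁻¹ := inv_anti₀ (by linarith) (by linarith)
  have h2 : 0 ≤ (1 + Metric.infDist p T)⁻¹ := by
    have := Metric.infDist_nonneg (x := p) (s := T); positivity
  exact pow_le_pow_left₀ h2 h1 3

/-- Collar count: `(2K+1)³ − (2(K−R)+1)³ ≤ 6 R (2K+1)²` for `R ≤ K`. [folklore] -/
theorem shp_collar_le (K R : ℕ) (hR : R ≤ K) :
    ((2 * K + 1 : ℕ) : ℝ) ^ 3 - ((2 * (K - R) + 1 : ℕ) : ℝ) ^ 3 ≤ 6 * R * ((2 * K + 1 : ℕ) : ℝ) ^ 2 := by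
  have hsub : ((K - R : ℕ) : ℝ) = K - R := by rw [Nat.cast_sub hR]
  push_cast
  rw [hsub]
  have hR' : (R : ℝ) ≤ K := by exact_mod_cast hR
  have hR0 : (0 : ℝ) ≤ R := by positivity
  nlinarith [mul_nonneg hR0 hR0, mul_nonneg hR0 (sub_nonneg.2 hR'), sq_nonneg ((K : ℝ) - R)]

/-- **The boundary functional is `o(#W_K)`.** For `a, h > 0`, a Hägg sequence `s`, a linear isometry `A` and every
`ε > 0`, for all large `K`: `∑_{p ∈ W_K} (1 + dist(p, S ∖ W_K))⁻³ ≤ ε (2K+1)³`. Deep points (index in the cube of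
size `K − R`) have weight `≤ (1 + (min a h/8)(R+1))⁻³ ≤ ε/2`; the collar has `≤ 6R(2K+1)²` points of weight `≤ 1`.
[folklore] -/
theorem shp_boundary_small {a h : ℝ} (ha : 0 < a) (hh : 0 < h) {s : ℤ → ℤ} (hs : IsHaggSeq s)
    (A : EuclideanSpace ℝ (Fin 3) →ₗᵢ[ℝ] EuclideanSpace ℝ (Fin 3)) {ε : ℝ} (hε : 0 < ε) :
    ∃ K₀ : ℕ, ∀ K : ℕ, K₀ ≤ K →
      ∑ p ∈ (hcpSumCube K).image (fun t : ℤ × ℤ × ℤ => A (barlowPos a h s t.1 t.2.1 t.2.2)),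
        (1 + Metric.infDist p (A '' barlowStacking a h s \
          ↑((hcpSumCube K).image fun t : ℤ × ℤ × ℤ => A (barlowPos a h s t.1 t.2.1 t.2.2))))⁻¹ ^ 3 ≤
        ε * ((2 * K + 1 : ℕ) : ℝ) ^ 3 := by
  set κ : ℝ := min a h / 8 with hκdef
  have hκ : 0 < κ := by positivity
  -- depth `R` with `(1 + κ (R+1))⁻³ ≤ ε/2`: it suffices that `κ (R + 1) ≥ 2/ε`
  obtain ⟨R, hR⟩ : ∃ R : ℕ, 2 / ε ≤ κ * ((R : ℝ) + 1) := by
    obtain ⟨R, hR⟩ := exists_nat_ge (2 / ε / κ)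
    refine ⟨R, ?_⟩
    rw [div_le_iff₀ hκ] at hR
    nlinarith
  have hdeep : (1 + κ * ((R : ℝ) + 1))⁻¹ ^ 3 ≤ ε / 2 := by
    have h1 : 2 / ε ≤ 1 + κ * ((R : ℝ) + 1) := by linarith
    have h2 : (1 + κ * ((R : ℝ) + 1))⁻¹ ≤ ε / 2 := by
      rw [inv_le_comm₀ (by positivity) (by positivity)]
      rwa [show (ε / 2)⁻¹ = 2 / ε by rw [inv_div]]
    have h3 : 0 ≤ (1 + κ * ((R : ℝ) + 1))⁻¹ := by positivity
    calc (1 + κ * ((R : ℝ) + 1))⁻¹ ^ 3 ≤ (1 + κ * ((R : ℝ) + 1))⁻¹ ^ 1 := by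
          refine pow_le_pow_of_le_one h3 ?_ (by norm_num)
          exact inv_le_one_of_one_le₀ (by nlinarith)
      _ ≤ ε / 2 := by rw [pow_one]; exact h2
  -- cube size with a thin collar: `6 R (2K+1)² ≤ (ε/2) (2K+1)³` once `12 R / ε ≤ 2K+1`
  obtain ⟨K₁, hK₁⟩ := exists_nat_ge (12 * (R : ℝ) / ε)
  refine ⟨max R K₁, fun K hK => ?_⟩
  have hRK : R ≤ K := (le_max_left _ _).trans hK
  have hK₁K : K₁ ≤ K := (le_max_right _ _).trans hK
  set e : ℤ × ℤ × ℤ → EuclideanSpace ℝ (Fin 3) := fun t => A (barlowPos a h s t.1 t.2.1 t.2.2) with he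
  have hinj : Function.Injective e := shp_param_injective ha hh s A
  set T : Set (EuclideanSpace ℝ (Fin 3)) := A '' barlowStacking a h s \ ↑((hcpSumCube K).image e) with hT
  set w : EuclideanSpace ℝ (Fin 3) → ℝ := fun p => (1 + Metric.infDist p T)⁻¹ ^ 3 with hw
  have hw0 : ∀ p, 0 ≤ w p := fun p => by
    have := Metric.infDist_nonneg (x := p) (s := T); simp only [hw]; positivity
  -- pass to the index cube and split it into the deep cube and the collar
  rw [Finset.sum_image fun x _ y _ hxy => hinj hxy]
  have hsplit := Finset.sum_sdiff (f := fun t => w (e t)) (hcpSumCube_mono (Nat.sub_le K R) : hcpSumCube (K - R) ⊆ hcpSumCube K)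
  rw [← hsplit]
  -- deep part
  have hdeepsum : ∑ t ∈ hcpSumCube (K - R), w (e t) ≤ ((2 * (K - R) + 1 : ℕ) : ℝ) ^ 3 * (ε / 2) := by
    have hbound : ∀ t ∈ hcpSumCube (K - R), w (e t) ≤ ε / 2 := by
      intro t ht
      rw [hcpSum_mem_hcpSumCube] at ht
      have hM : max |(t.1 : ℝ)| (max |(t.2.1 : ℝ)| |(t.2.2 : ℝ)|) ≤ ((K - R : ℕ) : ℝ) := by
        have h1 : |(t.1 : ℝ)| ≤ ((K - R : ℕ) : ℝ) := by exact_mod_cast ht.1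
        have h2 : |(t.2.1 : ℝ)| ≤ ((K - R : ℕ) : ℝ) := by exact_mod_cast ht.2.1
        have h3 : |(t.2.2 : ℝ)| ≤ ((K - R : ℕ) : ℝ) := by exact_mod_cast ht.2.2
        exact max_le h1 (max_le h2 h3)
      have hinf := shp_le_infDist_cube ha hh hs A K t hM
      have hKR : ((K : ℝ) + 1 - ((K - R : ℕ) : ℝ)) = (R : ℝ) + 1 := by
        rw [Nat.cast_sub hRK]; ring
      rw [hKR] at hinf
      calc w (e t) ≤ (1 + κ * ((R : ℝ) + 1))⁻¹ ^ 3 :=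
            shp_weight_le_of_le_infDist (by positivity) hinf
        _ ≤ ε / 2 := hdeep
    calc ∑ t ∈ hcpSumCube (K - R), w (e t) ≤ ∑ _t ∈ hcpSumCube (K - R), ε / 2 := Finset.sum_le_sum hbound
      _ = ((2 * (K - R) + 1 : ℕ) : ℝ) ^ 3 * (ε / 2) := by
          rw [Finset.sum_const, hcpSum_card_hcpSumCube, nsmul_eq_mul]; push_cast; ring
  -- collar part
  have hcollar : ∑ t ∈ hcpSumCube K \ hcpSumCube (K - R), w (e t) ≤ 6 * R * ((2 * K + 1 : ℕ) : ℝ) ^ 2 := by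
    calc ∑ t ∈ hcpSumCube K \ hcpSumCube (K - R), w (e t)
        ≤ ∑ _t ∈ hcpSumCube K \ hcpSumCube (K - R), (1 : ℝ) := Finset.sum_le_sum fun t _ => shp_weight_le_one _ _
      _ = ((hcpSumCube K \ hcpSumCube (K - R)).card : ℝ) := by simp
      _ = ((2 * K + 1 : ℕ) : ℝ) ^ 3 - ((2 * (K - R) + 1 : ℕ) : ℝ) ^ 3 := by
          rw [Finset.card_sdiff_of_subset (hcpSumCube_mono (Nat.sub_le K R)), hcpSum_card_hcpSumCube,
            hcpSum_card_hcpSumCube, Nat.cast_sub (Nat.pow_le_pow_left (by omega) 3)]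
          push_cast; ring
      _ ≤ 6 * R * ((2 * K + 1 : ℕ) : ℝ) ^ 2 := shp_collar_le K R hRK
  -- sizes
  have hcube_le : ((2 * (K - R) + 1 : ℕ) : ℝ) ^ 3 ≤ ((2 * K + 1 : ℕ) : ℝ) ^ 3 := by
    exact_mod_cast Nat.pow_le_pow_left (by omega) 3
  have hcol_le : 6 * R * ((2 * K + 1 : ℕ) : ℝ) ^ 2 ≤ (ε / 2) * ((2 * K + 1 : ℕ) : ℝ) ^ 3 := by
    have h1 : 12 * (R : ℝ) / ε ≤ K := hK₁.trans (by exact_mod_cast hK₁K)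
    rw [div_le_iff₀ hε] at h1
    have h2 : (0 : ℝ) ≤ ((2 * K + 1 : ℕ) : ℝ) ^ 2 := by positivity
    have h3 : 6 * (R : ℝ) ≤ (ε / 2) * ((2 * K + 1 : ℕ) : ℝ) := by push_cast; nlinarith
    calc 6 * R * ((2 * K + 1 : ℕ) : ℝ) ^ 2 = (6 * (R : ℝ)) * ((2 * K + 1 : ℕ) : ℝ) ^ 2 := by ring
      _ ≤ ((ε / 2) * ((2 * K + 1 : ℕ) : ℝ)) * ((2 * K + 1 : ℕ) : ℝ) ^ 2 := mul_le_mul_of_nonneg_right h3 h2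
      _ = (ε / 2) * ((2 * K + 1 : ℕ) : ℝ) ^ 3 := by ring
  have hε2 : 0 ≤ ε / 2 := by positivity
  calc ∑ t ∈ hcpSumCube K \ hcpSumCube (K - R), w (e t) + ∑ t ∈ hcpSumCube (K - R), w (e t)
      ≤ 6 * R * ((2 * K + 1 : ℕ) : ℝ) ^ 2 + ((2 * (K - R) + 1 : ℕ) : ℝ) ^ 3 * (ε / 2) := add_le_add hcollar hdeepsum
    _ ≤ (ε / 2) * ((2 * K + 1 : ℕ) : ℝ) ^ 3 + ((2 * K + 1 : ℕ) : ℝ) ^ 3 * (ε / 2) :=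
        add_le_add hcol_le (mul_le_mul_of_nonneg_right hcube_le hε2)
    _ = ε * ((2 * K + 1 : ℕ) : ℝ) ^ 3 := by ring

end Summit.AtomisticToContinuum.Crystallization.Theorems.PeriodicWindowsSketch

end
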